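/-
Copyright (c) 2026 the pub-hodgecm-mathlib formalisation cell (harness21).  Prover seat hodgecm-mathlib-K2E3-p32 (g3), Track B «K2-LIT» (E3 valve hand → L1),
hLiu418 = `stmt-HodgeConjecture-24832`; socket #41, KIND 1 a♮ «the X₀₁-plane step», organ K1-a♮ (line lead ∕ K1a desk K2E5-p16 (g8), NAME 2026-09-05T00:43:09Z under
LEAD F0P6-plan (g15) BATCH #195), brick (K1a-supp-loc) «THE PLACE-`w ∈ T` SUPPORT LETTER WITH THE HEIGHT».  THEOREMS ONLY (no `def`, no `instance`, no notation,
no named-fact hypothesis, no `sorry`); lane `--supports stmt-HodgeConjecture-24832 --as helper` (count-neutral helper; closes no socket by itself).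
-/
import Summits.HodgeConjecture.HodgeConjecture.Theorems.K2LiuRankOneStageTwistedSupport      -- ★ p863373 (K2E5-p16 g8): `v_le_exp_of_ballPresented_ne_zero` (support letter at level `m`)
import Summits.HodgeConjecture.HodgeConjecture.Theorems.K2LiuLocalHeightLevelConjugation       -- ★ (c1) p862721 (K2E3-p26 g2): `conj_mem_congruenceGL_of_localHeight_le`, `exists_localHeight_eq_pow`, `one_lt_absNorm_nnreal`
import HarnessLib

/-!
# Crux `HLiu418`, socket #41, K1-a♮, brick (K1a-supp-loc): the place-`w` support letter of the twisted rank-one stage WITH THE HEIGHT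
# «`N ≠ 0 ⟹ |σ|_w ≤ q_w^{c + 2a − d}`, `q_w^a = H_w(g)`» and its DENOMINATOR form «`D := q_w^{(c+2a−d)⁺}`, `D ≤ q_w^{(c−d)⁺}·H_w(g)²`, `|D·σ|_w ≤ 1`»

HONEST LABEL: HC_CM is proved only modulo the 7 printed citations (2 remaining named inputs: hLiu418 = `stmt-HodgeConjecture-24832`,
h413 = `stmt-HodgeConjecture-24833`) until rung 0 closes.  This file is a count-neutral helper: it closes no socket.

THE POINT.  ★ p863373 `K2LiuRankOneStageTwistedSupport.v_le_exp_of_ballPresented_ne_zero` is the support letter of the ψ-twisted rank-one stage at an ABSTRACT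
level `m`: if `N` is presented by the twisted ball values `∫_{𝔭^{−k}} conj ψ(σx) · f(w₀ u(x) y) dμ` (★ `…StageTwistedBall` (iii)), `f` is right-`K′`-invariant and
`y⁻¹ u(𝔭_w^m) y ⊆ K′`, then `N ≠ 0 ⟹ |σ|_w ≤ exp(m − d)` (`d` the conductor exponent of `ψ`).  The K1-a♮ package (★ p863404 §2 (iii) `hsupp`, today unpaid) needs
the level `m` READ OFF THE HEIGHT of the translate: this is ★ (c1) `K2LiuLocalHeightLevelConjugation` — an adelic point `g` of local height `H_w(g) ≤ q_w^a` conjugates the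
congruence level `K_w(ϖ^{c+2a})` into `K_w(ϖ^c)` (`conj_mem_congruenceGL_of_localHeight_le`), and `H_w(g) = q_w^a` for some `a : ℕ` (`exists_localHeight_eq_pow`).  So for `f`
right-`K_w(ϖ^c)`-invariant and a root subgroup `u` with `u(𝔭^{c+2a}) ⊆ K_w(ϖ^{c+2a})`, the stage translated by `g_w` has level `m := c + 2a`:
* §1 **`forall_mem_primePowBall_conj_map_mem`** — the level letter `hmu` of ★ p863373 at `m := c + 2a`, transported along ANY place inclusion `ι : GL_N(L_w) →* G` into a
  right level `K′ ⊇ ι(K_w(ϖ^c))`, for any `y ∈ G` conjugating like `g_w` on the image of `ι` (`y⁻¹·ι k·y = ι(g_w⁻¹ k g_w)` — `y = g_w` when `G = GL_N(L_w)`, `y = h` with `h_w = g_w`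
  in a restricted product); **`v_le_exp_height_of_ballPresented_ne_zero_map`** (generic `G`, `ι`, `y`) and **`v_le_exp_height_of_ballPresented_ne_zero`** (`G = GL_N(L_w)`,
  `ι = id`, `y = g_w`): `N ≠ 0 ⟹ |σ|_w ≤ exp(c + 2a − d)`.
* §2 DENOMINATOR WORDS for the package: `valued_natCast_absNorm_le_exp_neg_one` (`|q_w|_w ≤ exp(−1)`: `q_w = N𝔭_w ∈ 𝔭_w`, Mathlib `Ideal.absNorm_mem`),
  **`exists_denominator_of_v_le_exp`** — from `|σ|_w ≤ exp(c + 2a − d)` and `H_w(g) = q_w^a`: `D := q_w^{(c+2a−d)⁺} ≥ 1`, `(D : ℝ≥0) ≤ q_w^{(c−d)⁺} · H_w(g)^2`, `|D·σ|_w ≤ 1` —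
  and the composed **`exists_denominator_of_ballPresented_ne_zero`**.  (The global `hsupp` letter `∃ D, 1 ≤ D ∧ D ≤ Ca·H(h)^κa ∧ ∀ i j, IsIntegral ℤ (D·S i j)` is the product
  over `w ∈ T` of these local `D_w` — natural numbers, so harmless at every other place — against integrality off `T`; that assembly is the package's, not this file's.)
Everything is Haar-free beyond ★ p863373's right-invariant `μ`, valuation-only (`primePowBall`, `congruenceGL`, `Valued.v`), and hypothesis-first.

## Census (★ by name)
★ p863373 `K2LiuRankOneStageTwistedSupport.v_le_exp_of_ballPresented_ne_zero` · ★ (c1) `K2LiuLocalHeightLevelConjugation.{conj_mem_congruenceGL_of_localHeight_le,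
exists_localHeight_eq_pow, one_lt_absNorm_nnreal}` · ★ Lit `AddCharConductorExponent.mem_primePowBall_adicCompletion_iff` · ★ Lit `GLnCongruenceSubgroups.congruenceGL` ·
★ Lit `AdelicHeightGLProofs` (`GLn.localHeight`) · Mathlib `Ideal.absNorm_mem`, `IsDedekindDomain.HeightOneSpectrum.valuation_lt_one_iff_mem`,
`valuedAdicCompletion_eq_valuation`, `WithZero.exp_*`.
presearch: «Whittaker ∕ Fourier coefficient of a level-`K(𝔭^c)` vector translated by `g` vanishes off `𝔭^{d − c − 2·ord H(g)}`» → [Casselman1980 §3] (conductor of the Whittaker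
functional), [BorelJacquet1979 §1.2, §4.1] (heights, levels), [MoeglinWaldspurger1995 I.2.2] (`‖g‖` and conjugation of compact opens), [Shimura1997 §18.4] (denominators of
Fourier coefficients bounded by the level); corpus+galaxy: the tree's ★ p863373 + ★ (c1) ARE the method — this file only composes them.
-/

set_option autoImplicit false
set_option linter.dupNamespace false -- the mandated namespace repeats `HodgeConjecture.HodgeConjecture`

noncomputable section

open scoped NNReal MatrixGroups WithZero ComplexConjugate
open NumberField IsDedekindDomain MeasureTheory Matrix ValuativeRel
open Literature.NumberTheory.Automorphic

namespace Summit.HodgeConjecture.HodgeConjecture.Cruxes.HLiu418.K2LiuRankOneStageTwistedSupportHeight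

open Summit.HodgeConjecture.HodgeConjecture.Cruxes.HLiu418.K2LiuRankOneStageTwistedSupport (v_le_exp_of_ballPresented_ne_zero)
open Summit.HodgeConjecture.HodgeConjecture.Cruxes.HLiu418.K2LiuLocalHeightLevelConjugation
  (conj_mem_congruenceGL_of_localHeight_le exists_localHeight_eq_pow one_lt_absNorm_nnreal)

variable (L : Type) [Field L] [NumberField L] (w : HeightOneSpectrum (𝓞 L)) {N : ℕ}

/-! ## §1 The level letter of the twisted stage read off the local height, and the support letter with the height -/

/-- **LEVEL FROM HEIGHT, transported along a place inclusion.**  `ι : GL_N(L_w) →* G` a group morphism into a right level `K′ ≤ G` containing `ι(K_w(ϖ^c))`; `g` an adelic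
point with `H_w(g) ≤ q_w^a`; `y ∈ G` conjugating like `g_w` on the image of `ι` (`y⁻¹·ι k·y = ι(g_w⁻¹ k g_w)`); `u : L_w → GL_N(L_w)` with `u(t) ∈ K_w(ϖ^{c+2a})` for
`|t|_w ≤ exp(−(c+2a))`.  Then `y⁻¹ · ι(u t) · y ∈ K′` for every `t ∈ 𝔭_w^{c+2a}` — the level letter `hmu` of ★ p863373 at `m := c + 2a`, by ★ (c1)
`conj_mem_congruenceGL_of_localHeight_le` (`g_w⁻¹ K_w(ϖ^{c+2a}) g_w ⊆ K_w(ϖ^c)`). [cite: BorelJacquet1979, §1.2, §4.1] [cite: MoeglinWaldspurger1995, I.2.2] [cite: HarishChandra1999, §17 p. 80] -/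
theorem forall_mem_primePowBall_conj_map_mem {G : Type*} [Group G] (ι : GL (Fin N) (w.adicCompletion L) →* G) (K' : Subgroup G)
    {c : ℕ} {ϖ : w.adicCompletion L} (hϖ : Valued.v ϖ = WithZero.exp (-1 : ℤ))
    (hιK : ∀ k ∈ congruenceGL N (valuation (w.adicCompletion L) ϖ ^ c), ι k ∈ K')
    (g : GL (Fin N) (AdeleRing (𝓞 L) L)) {a : ℕ} (hH : GLn.localHeight N L w g ≤ ((Ideal.absNorm w.asIdeal : ℕ) : ℝ≥0) ^ a)
    (y : G) (hy : ∀ k : GL (Fin N) (w.adicCompletion L), y⁻¹ * ι k * y =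
      ι ((Matrix.GeneralLinearGroup.map (AdelicGroupData.adeleEval L w) g)⁻¹ * k * Matrix.GeneralLinearGroup.map (AdelicGroupData.adeleEval L w) g))
    {u : w.adicCompletion L → GL (Fin N) (w.adicCompletion L)}
    (hu : ∀ t : w.adicCompletion L, Valued.v t ≤ WithZero.exp (-((c + 2 * a : ℕ) : ℤ)) →
      u t ∈ congruenceGL N (valuation (w.adicCompletion L) ϖ ^ (c + 2 * a))) :
    ∀ t ∈ primePowBall (w.adicCompletion L) ((c + 2 * a : ℕ) : ℤ), y⁻¹ * ι (u t) * y ∈ K' := by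
  intro t ht
  rw [hy]
  exact hιK _ (conj_mem_congruenceGL_of_localHeight_le L w g c a hH hϖ (hu t ((mem_primePowBall_adicCompletion_iff w).1 ht))).2

/-- **THE SUPPORT LETTER WITH THE HEIGHT (generic place inclusion).**  In the currency of ★ p863373 (`f : G → ℂ` right-`K′`-invariant, `ψ` of conductor exponent `d`, a
twist `σ`, a number `N₀` presented by the twisted ball values `∫_{𝔭^{−k}} conj ψ(σx) · f(w₀ · ι(u x) · y) dμ(x)` for all `k ≥ k₀`), with the level supplied by the HEIGHT:
`K′ ⊇ ι(K_w(ϖ^c))`, `H_w(g) ≤ q_w^a`, `y` conjugating like `g_w` on `ι`, `u` a root subgroup (`u(x+t) = u(x)u(t)`) with `u(𝔭_w^{c+2a}) ⊆ K_w(ϖ^{c+2a})`.  THEN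
`N₀ ≠ 0 ⟹ |σ|_w ≤ exp(c + 2a − d)` — ★ p863373 `v_le_exp_of_ballPresented_ne_zero` at `m := c + 2a` with `hmu := forall_mem_primePowBall_conj_map_mem`.
[cite: Casselman1980, §3 Thm. 3.1] [cite: Shimura1997, §18.4] [cite: BorelJacquet1979, §1.2, §4.1] [cite: Tate1950, §2.2] -/
theorem v_le_exp_height_of_ballPresented_ne_zero_map {G : Type*} [Group G]
    [MeasurableSpace (w.adicCompletion L)] [BorelSpace (w.adicCompletion L)] (μ : Measure (w.adicCompletion L)) [μ.IsAddRightInvariant]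
    {f : G → ℂ} {K' : Subgroup G} (hfK : ∀ x, ∀ k ∈ K', f (x * k) = f x)
    (ι : GL (Fin N) (w.adicCompletion L) →* G) {c : ℕ} {ϖ : w.adicCompletion L} (hϖ : Valued.v ϖ = WithZero.exp (-1 : ℤ))
    (hιK : ∀ k ∈ congruenceGL N (valuation (w.adicCompletion L) ϖ ^ c), ι k ∈ K')
    {u : w.adicCompletion L → GL (Fin N) (w.adicCompletion L)} (hu_add : ∀ x t, u (x + t) = u x * u t)
    (g : GL (Fin N) (AdeleRing (𝓞 L) L)) {a : ℕ} (hH : GLn.localHeight N L w g ≤ ((Ideal.absNorm w.asIdeal : ℕ) : ℝ≥0) ^ a)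
    (hu : ∀ t : w.adicCompletion L, Valued.v t ≤ WithZero.exp (-((c + 2 * a : ℕ) : ℤ)) →
      u t ∈ congruenceGL N (valuation (w.adicCompletion L) ϖ ^ (c + 2 * a)))
    (w₀ y : G) (hy : ∀ k : GL (Fin N) (w.adicCompletion L), y⁻¹ * ι k * y =
      ι ((Matrix.GeneralLinearGroup.map (AdelicGroupData.adeleEval L w) g)⁻¹ * k * Matrix.GeneralLinearGroup.map (AdelicGroupData.adeleEval L w) g))
    {ψ : AddChar (w.adicCompletion L) Circle} {d : ℤ} (hψ : ψ.HasConductorExp d) {σ : w.adicCompletion L} {N₀ : ℂ} {k₀ : ℕ}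
    (hball : ∀ k : ℕ, k₀ ≤ k →
      N₀ = ∫ x in primePowBall (w.adicCompletion L) (-(k : ℤ)), conj ((ψ (σ * x) : ℂ)) * f (w₀ * ι (u x) * y) ∂μ)
    (hN : N₀ ≠ 0) : Valued.v σ ≤ WithZero.exp (((c + 2 * a : ℕ) : ℤ) - d) :=
  v_le_exp_of_ballPresented_ne_zero μ hfK (u := fun x => ι (u x)) (fun x t => by simp only [hu_add, map_mul]) w₀ y
    (forall_mem_primePowBall_conj_map_mem L w ι K' hϖ hιK g hH y hy hu) hψ hball hN

/-- **THE SUPPORT LETTER WITH THE HEIGHT (the place group itself: `G = GL_N(L_w)`, `ι = id`, `y = g_w`).**  `f : GL_N(L_w) → ℂ` right-`K_w(ϖ^c)`-invariant, `u` a root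
subgroup with `u(𝔭_w^{c+2a}) ⊆ K_w(ϖ^{c+2a})`, `H_w(g) ≤ q_w^a`, `ψ` of conductor exponent `d`, `N₀` presented by the twisted ball values
`∫_{𝔭^{−k}} conj ψ(σx) · f(w₀ u(x) g_w) dμ(x)` (`k ≥ k₀`).  THEN `N₀ ≠ 0 ⟹ |σ|_w ≤ exp(c + 2a − d)`: the place-`w ∈ T` half of K1-a♮'s support letter with the level
`m = c + 2a` of the translate read off its height (`q_w^a = H_w(g)` by ★ (c1) `exists_localHeight_eq_pow`).
[cite: Casselman1980, §3 Thm. 3.1] [cite: Shimura1997, §18.4] [cite: BorelJacquet1979, §1.2, §4.1] [cite: Tate1950, §2.2] -/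
theorem v_le_exp_height_of_ballPresented_ne_zero
    [MeasurableSpace (w.adicCompletion L)] [BorelSpace (w.adicCompletion L)] (μ : Measure (w.adicCompletion L)) [μ.IsAddRightInvariant]
    {f : GL (Fin N) (w.adicCompletion L) → ℂ} {c : ℕ} {ϖ : w.adicCompletion L} (hϖ : Valued.v ϖ = WithZero.exp (-1 : ℤ))
    (hfK : ∀ x, ∀ k ∈ congruenceGL N (valuation (w.adicCompletion L) ϖ ^ c), f (x * k) = f x)
    {u : w.adicCompletion L → GL (Fin N) (w.adicCompletion L)} (hu_add : ∀ x t, u (x + t) = u x * u t)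
    (g : GL (Fin N) (AdeleRing (𝓞 L) L)) {a : ℕ} (hH : GLn.localHeight N L w g ≤ ((Ideal.absNorm w.asIdeal : ℕ) : ℝ≥0) ^ a)
    (hu : ∀ t : w.adicCompletion L, Valued.v t ≤ WithZero.exp (-((c + 2 * a : ℕ) : ℤ)) →
      u t ∈ congruenceGL N (valuation (w.adicCompletion L) ϖ ^ (c + 2 * a)))
    (w₀ : GL (Fin N) (w.adicCompletion L))
    {ψ : AddChar (w.adicCompletion L) Circle} {d : ℤ} (hψ : ψ.HasConductorExp d) {σ : w.adicCompletion L} {N₀ : ℂ} {k₀ : ℕ}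
    (hball : ∀ k : ℕ, k₀ ≤ k →
      N₀ = ∫ x in primePowBall (w.adicCompletion L) (-(k : ℤ)), conj ((ψ (σ * x) : ℂ)) *
        f (w₀ * u x * Matrix.GeneralLinearGroup.map (AdelicGroupData.adeleEval L w) g) ∂μ)
    (hN : N₀ ≠ 0) : Valued.v σ ≤ WithZero.exp (((c + 2 * a : ℕ) : ℤ) - d) :=
  v_le_exp_height_of_ballPresented_ne_zero_map L w μ hfK (MonoidHom.id _) hϖ (fun _ hk => hk) hu_add g hH hu w₀
    (Matrix.GeneralLinearGroup.map (AdelicGroupData.adeleEval L w) g) (fun _ => rfl) hψ hball hN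

/-! ## §2 Denominator words: `D := q_w^{(c + 2a − d)⁺}` -/

/-- **`|q_w|_w ≤ exp(−1)`**: the residue cardinality `q_w = N𝔭_w`, as an element of `L_w`, lies in the maximal ideal (Mathlib `Ideal.absNorm_mem`: `N𝔭_w ∈ 𝔭_w`,
read in `L_w` through `valuedAdicCompletion_eq_valuation` ∕ `intValuation_le_pow_iff_mem`). [cite: BorelJacquet1979, §1.2] -/
theorem valued_natCast_absNorm_le_exp_neg_one :
    Valued.v ((Ideal.absNorm w.asIdeal : ℕ) : w.adicCompletion L) ≤ WithZero.exp (-1 : ℤ) := by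
  have hv := IsDedekindDomain.HeightOneSpectrum.valuedAdicCompletion_eq_valuation (K := L) w ((Ideal.absNorm w.asIdeal : ℕ) : 𝓞 L)
  change Valued.v (algebraMap (𝓞 L) (w.adicCompletion L) ((Ideal.absNorm w.asIdeal : ℕ) : 𝓞 L)) = _ at hv
  rw [map_natCast, IsDedekindDomain.HeightOneSpectrum.valuation_of_algebraMap] at hv
  have h := (IsDedekindDomain.HeightOneSpectrum.intValuation_le_pow_iff_mem w ((Ideal.absNorm w.asIdeal : ℕ) : 𝓞 L) 1).2
    (by rw [pow_one]; exact Ideal.absNorm_mem _)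
  rw [hv]
  simpa using h

/-- **DENOMINATORS FROM THE SUPPORT BOUND.**  From `|σ|_w ≤ exp(c + 2a − d)` and `H_w(g) = q_w^a`: with `D := q_w^{(c + 2a − d)⁺}` one has `1 ≤ D`,
`(D : ℝ≥0) ≤ q_w^{(c − d)⁺} · H_w(g)^2` and `|D · σ|_w ≤ 1` (`|q_w|_w ≤ exp(−1)`).  These are the place-`w` DENOMINATOR WORDS of K1-a♮'s `hsupp`
(`∃ D, 1 ≤ D ∧ D ≤ C·H^κ ∧ D·σ integral`): the global letter multiplies the `D_w` over `w ∈ T`. [cite: Shimura1997, §18.4] [cite: BorelJacquet1979, §1.2, §4.1] -/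
theorem exists_denominator_of_v_le_exp {σ : w.adicCompletion L} {c a : ℕ} {d : ℤ} (hσ : Valued.v σ ≤ WithZero.exp (((c + 2 * a : ℕ) : ℤ) - d))
    (g : GL (Fin N) (AdeleRing (𝓞 L) L)) (ha : GLn.localHeight N L w g = ((Ideal.absNorm w.asIdeal : ℕ) : ℝ≥0) ^ a) :
    ∃ D : ℕ, 1 ≤ D ∧ (D : ℝ≥0) ≤ ((Ideal.absNorm w.asIdeal : ℕ) : ℝ≥0) ^ ((c : ℤ) - d).toNat * GLn.localHeight N L w g ^ 2 ∧
      Valued.v ((D : w.adicCompletion L) * σ) ≤ 1 := by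
  set q : ℕ := Ideal.absNorm w.asIdeal with hq
  set n : ℕ := (((c + 2 * a : ℕ) : ℤ) - d).toNat with hn
  have hq0 : q ≠ 0 := fun h => w.ne_bot (Ideal.absNorm_eq_zero_iff.1 h)
  refine ⟨q ^ n, Nat.one_le_pow _ _ (Nat.pos_of_ne_zero hq0), ?_, ?_⟩
  · -- `q^n ≤ q^{(c-d)⁺ + 2a} = q^{(c-d)⁺} · (q^a)^2`
    have hle : n ≤ ((c : ℤ) - d).toNat + 2 * a := by
      refine Int.toNat_le.2 ?_
      have h1 := Int.self_le_toNat ((c : ℤ) - d)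
      push_cast
      omega
    rw [Nat.cast_pow, ha, ← pow_mul, ← pow_add]
    exact pow_le_pow_right₀ (one_lt_absNorm_nnreal L w).le (by omega)
  · -- `|q^n · σ|_w ≤ exp(−n) · exp(c + 2a − d) ≤ 1`
    have hqv : Valued.v ((q : ℕ) : w.adicCompletion L) ≤ WithZero.exp (-1 : ℤ) := valued_natCast_absNorm_le_exp_neg_one L w
    have hle : -(n : ℤ) + ((((c + 2 * a : ℕ) : ℤ)) - d) ≤ 0 := by
      have h1 := Int.self_le_toNat ((((c + 2 * a : ℕ) : ℤ)) - d)
      omega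
    calc Valued.v (((q ^ n : ℕ) : w.adicCompletion L) * σ)
        = Valued.v ((q : ℕ) : w.adicCompletion L) ^ n * Valued.v σ := by rw [Nat.cast_pow, map_mul, map_pow]
      _ ≤ WithZero.exp (-1 : ℤ) ^ n * WithZero.exp (((c + 2 * a : ℕ) : ℤ) - d) := mul_le_mul' (pow_le_pow_left' hqv n) hσ
      _ = WithZero.exp (-(n : ℤ) + ((((c + 2 * a : ℕ) : ℤ)) - d)) := by
          rw [WithZero.exp_add, ← WithZero.exp_nsmul, nsmul_eq_mul, mul_neg, mul_one]
      _ ≤ WithZero.exp 0 := WithZero.exp_le_exp.2 hle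
      _ = 1 := WithZero.exp_zero

/-- **THE SUPPORT LETTER IN DENOMINATOR WORDS (composed).**  Under the hypotheses of `v_le_exp_height_of_ballPresented_ne_zero` with `H_w(g) = q_w^a`
(★ (c1) `exists_localHeight_eq_pow`): `N₀ ≠ 0 ⟹ ∃ D : ℕ, 1 ≤ D ∧ (D : ℝ≥0) ≤ q_w^{(c−d)⁺} · H_w(g)^2 ∧ |D · σ|_w ≤ 1`.
[cite: Casselman1980, §3 Thm. 3.1] [cite: Shimura1997, §18.4] [cite: BorelJacquet1979, §1.2, §4.1] -/
theorem exists_denominator_of_ballPresented_ne_zero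
    [MeasurableSpace (w.adicCompletion L)] [BorelSpace (w.adicCompletion L)] (μ : Measure (w.adicCompletion L)) [μ.IsAddRightInvariant]
    {f : GL (Fin N) (w.adicCompletion L) → ℂ} {c : ℕ} {ϖ : w.adicCompletion L} (hϖ : Valued.v ϖ = WithZero.exp (-1 : ℤ))
    (hfK : ∀ x, ∀ k ∈ congruenceGL N (valuation (w.adicCompletion L) ϖ ^ c), f (x * k) = f x)
    {u : w.adicCompletion L → GL (Fin N) (w.adicCompletion L)} (hu_add : ∀ x t, u (x + t) = u x * u t)
    (g : GL (Fin N) (AdeleRing (𝓞 L) L)) {a : ℕ} (ha : GLn.localHeight N L w g = ((Ideal.absNorm w.asIdeal : ℕ) : ℝ≥0) ^ a)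
    (hu : ∀ t : w.adicCompletion L, Valued.v t ≤ WithZero.exp (-((c + 2 * a : ℕ) : ℤ)) →
      u t ∈ congruenceGL N (valuation (w.adicCompletion L) ϖ ^ (c + 2 * a)))
    (w₀ : GL (Fin N) (w.adicCompletion L))
    {ψ : AddChar (w.adicCompletion L) Circle} {d : ℤ} (hψ : ψ.HasConductorExp d) {σ : w.adicCompletion L} {N₀ : ℂ} {k₀ : ℕ}
    (hball : ∀ k : ℕ, k₀ ≤ k →
      N₀ = ∫ x in primePowBall (w.adicCompletion L) (-(k : ℤ)), conj ((ψ (σ * x) : ℂ)) *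
        f (w₀ * u x * Matrix.GeneralLinearGroup.map (AdelicGroupData.adeleEval L w) g) ∂μ)
    (hN : N₀ ≠ 0) :
    ∃ D : ℕ, 1 ≤ D ∧ (D : ℝ≥0) ≤ ((Ideal.absNorm w.asIdeal : ℕ) : ℝ≥0) ^ ((c : ℤ) - d).toNat * GLn.localHeight N L w g ^ 2 ∧
      Valued.v ((D : w.adicCompletion L) * σ) ≤ 1 :=
  exists_denominator_of_v_le_exp L w (v_le_exp_height_of_ballPresented_ne_zero L w μ hϖ hfK hu_add g ha.le hu w₀ hψ hball hN) g ha

end Summit.HodgeConjecture.HodgeConjecture.Cruxes.HLiu418.K2LiuRankOneStageTwistedSupportHeight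

end
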